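import Mathlib
import Summits.AtomisticToContinuum.Crystallization.Theorems.GappedShellCensusCleanLimitsHaveWindowsLayeredAtlas

/-!
# Exactly layered shells ⇒ exactly layered set, file 2: rigidity of the perfect cuboctahedron

Crux `GappedShellCensus.CleanLimitsHaveWindows` (stmt-AtomisticToContinuum-15932), line `Sketch`, support for
`stub_layeredOfExactShells`.  A cubic-type slot model with both heights ideal (`3k² = 2a'²`) is a perfect
cuboctahedron `K` (all slots at distance `a'`), a slot model over FOUR hexagonal planes: its frame is not determined
by the point set.  What IS determined: `cuboct_marked_edge` — a perfect cuboctahedron `p + A' K` containing the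
adjacent points `p + A u`, `p + A v` of another frame `A` is `p + A K` or its twin `p + A R_π K` (`R_π` = half turn
about `e₃`, `laHalfTurn`); proof: every slot is an INTEGER combination of `u, v, w + k e₃` (fcc coordinates
`laFcc`), the apex over the marked edge is `A (w ± k e₃)` (`apex_eq`), and the 48 marked-edge substitutions permute
the twelve codes (`decide`).  Anchor `stub_cuboctStep`: if every bond shell of `Z` is a perfect cuboctahedron, the
shell of the in-plane neighbour `p + A u` is the translate of the shell of `p` (the twin misses the common cap point
`p + A (w + k e₃)`).
-/

noncomputable section

namespace Summit.AtomisticToContinuum.Crystallization.Theorems.CleanHull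

open Literature.MathematicalPhysics.StatisticalMechanics

/-! ## Linear code points and the half turn -/

/-- For equal heights `k` the code point depends linearly on the code: `(x/3) u + (y/3) v + (ℓ k) e₃`. [folklore] -/
def laLin (a' k : ℝ) (c : ℤ × ℤ × ℤ) : EuclideanSpace ℝ (Fin 3) :=
  ((c.1 : ℝ) / 3) • triangularVec₁ a' + ((c.2.1 : ℝ) / 3) • triangularVec₂ a' + ((c.2.2 : ℝ) * k) • layerNormal 1

/-- Levels of the cubic codes. [folklore] -/
theorem laCodeC_level (i : Fin 12) : (laCodeC i).2.2 = 0 ∨ (laCodeC i).2.2 = 1 ∨ (laCodeC i).2.2 = -1 := by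
  revert i; decide

/-- The cubic slots with equal heights as linear code points. [folklore] -/
theorem slotC_eq_laLin (a' k : ℝ) (i : Fin 12) : slotC a' k k i = laLin a' k (laCodeC i) := by
  rw [slotC_eq_laPt]
  simp only [laPt, laLin, laHt]
  rcases laCodeC_level i with h | h | h <;> simp [h]

/-- Linearity of `laLin` in the code. [folklore] -/
theorem laLin_comb (a' k : ℝ) (n₁ n₂ n₃ : ℤ) (c d f : ℤ × ℤ × ℤ) :
    laLin a' k (n₁ • c + n₂ • d + n₃ • f) =
      (n₁ : ℝ) • laLin a' k c + (n₂ : ℝ) • laLin a' k d + (n₃ : ℝ) • laLin a' k f := by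
  simp only [laLin, Prod.fst_add, Prod.snd_add, Prod.smul_fst, Prod.smul_snd, smul_eq_mul, Int.cast_add,
    Int.cast_mul]
  module

/-- Negation of a linear code point. [folklore] -/
theorem laLin_neg (a' k : ℝ) (c : ℤ × ℤ × ℤ) : laLin a' k (-c) = -laLin a' k c := by
  simp only [laLin, Prod.fst_neg, Prod.snd_neg, Int.cast_neg]
  module

/-- `laLin` is injective in the code (`a' ≠ 0 ≠ k`). [folklore] -/
theorem laLin_injective {a' k : ℝ} (ha' : a' ≠ 0) (hk : k ≠ 0) : Function.Injective (laLin a' k) := by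
  intro c d h
  have h0 := congrArg (fun v : EuclideanSpace ℝ (Fin 3) => v 0) h
  have h1 := congrArg (fun v : EuclideanSpace ℝ (Fin 3) => v 1) h
  have h2 := congrArg (fun v : EuclideanSpace ℝ (Fin 3) => v 2) h
  simp only [laLin, triangularVec₁, triangularVec₂, layerNormal, PiLp.add_apply, PiLp.smul_apply, smul_eq_mul]
    at h0 h1 h2
  simp at h0 h1 h2
  have e1 : c.2.1 = d.2.1 := h1.resolve_right ha'
  have e1r : (c.2.1 : ℝ) = d.2.1 := by exact_mod_cast e1
  have e0 : ((c.1 : ℝ) - d.1) * a' = 0 := by rw [e1r] at h0; linarith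
  have e0i : c.1 = d.1 := by
    exact_mod_cast (by have := (mul_eq_zero.1 e0).resolve_right ha'; linarith : (c.1 : ℝ) = d.1)
  exact Prod.ext e0i (Prod.ext e1 (h2.resolve_right hk))

/-- `u`, `v`, `w ± k e₃` and `w - u + k e₃` as linear code points. [folklore] -/
theorem laLin_basis (a' k : ℝ) :
    laLin a' k (3, 0, 0) = triangularVec₁ a' ∧ laLin a' k (0, 3, 0) = triangularVec₂ a' ∧
      laLin a' k (1, 1, 1) = barlowOffset a' + k • layerNormal 1 ∧
      laLin a' k (1, 1, -1) = barlowOffset a' - k • layerNormal 1 ∧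
      laLin a' k (-2, 1, 1) = barlowOffset a' - triangularVec₁ a' + k • layerNormal 1 := by
  refine ⟨?_, ?_, ?_, ?_, ?_⟩ <;> ext l <;> fin_cases l <;>
    simp [laLin, triangularVec₁, triangularVec₂, barlowOffset, layerNormal] <;> ring

/-- The half turn `R_π` about the normal `e₃` (reflection in the line `ℝ e₃`). [folklore] -/
def laHalfTurn : EuclideanSpace ℝ (Fin 3) ≃ₗᵢ[ℝ] EuclideanSpace ℝ (Fin 3) :=
  (ℝ ∙ (layerNormal (1 : ℝ) : EuclideanSpace ℝ (Fin 3))).reflection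

/-- `R_π` fixes `e₃` and negates `u`, `v`. [folklore] -/
theorem laHalfTurn_basis (a' : ℝ) :
    laHalfTurn (layerNormal 1) = layerNormal 1 ∧ laHalfTurn (triangularVec₁ a') = -triangularVec₁ a' ∧
      laHalfTurn (triangularVec₂ a') = -triangularVec₂ a' := by
  refine ⟨Submodule.reflection_mem_subspace_eq_self (Submodule.mem_span_singleton_self _), ?_, ?_⟩ <;>
    refine Submodule.reflection_mem_subspace_orthogonalComplement_eq_neg
      ((Submodule.mem_orthogonal_singleton_iff_inner_right).2 ?_) <;>
    simp [EuclideanSpace.inner_eq_star_dotProduct, triangularVec₁, triangularVec₂, layerNormal, dotProduct,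
      Fin.sum_univ_three]

/-- `R_π` on linear code points: `(x, y, ℓ) ↦ (-x, -y, ℓ)`; `R_π` is an involution. [folklore] -/
theorem laHalfTurn_laLin (a' k : ℝ) (c : ℤ × ℤ × ℤ) :
    laHalfTurn (laLin a' k c) = laLin a' k (-c.1, -c.2.1, c.2.2) ∧ ∀ x, laHalfTurn (laHalfTurn x) = x := by
  obtain ⟨he, hu, hv⟩ := laHalfTurn_basis a'
  refine ⟨?_, fun x => Submodule.reflection_reflection _ x⟩
  simp only [laLin, map_add, map_smul, he, hu, hv, Int.cast_neg]
  module

/-! ## Combinatorics of the cuboctahedron (`decide`) -/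

/-- The fcc coordinates `(n₁, n₂, n₃)` of the cubic codes: `code = n₁ (3,0,0) + n₂ (0,3,0) + n₃ (1,1,1)`. [folklore] -/
def laFcc : Fin 12 → ℤ × ℤ × ℤ :=
  ![(1, 0, 0), (-1, 0, 0), (0, 1, 0), (0, -1, 0), (1, -1, 0), (-1, 1, 0),
    (0, 0, 1), (-1, 0, 1), (0, -1, 1), (0, 0, -1), (1, 0, -1), (0, 1, -1)]

/-- The apex over a marked edge: the slot adjacent to both ends (junk if the pair is not an edge). [folklore] -/
def laApex (i j : Fin 12) : Fin 12 :=
  ((List.finRange 12).find? fun m => laAdj (laCodeC i) (laCodeC m) && laAdj (laCodeC j) (laCodeC m)).getD 0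

/-- The codes through their fcc coordinates, with the level scaled by `ε = ±1`. [folklore] -/
theorem laCodeC_eq_fcc (ε : ℤ) (hε : ε = 1 ∨ ε = -1) (m : Fin 12) :
    ((laCodeC m).1, (laCodeC m).2.1, ε * (laCodeC m).2.2) = (laFcc m).1 • ((3, 0, 0) : ℤ × ℤ × ℤ) +
      (laFcc m).2.1 • ((0, 3, 0) : ℤ × ℤ × ℤ) + (laFcc m).2.2 • ((1, 1, ε) : ℤ × ℤ × ℤ) := by
  rcases hε with rfl | rfl <;> revert m <;> decide

/-- The apex of an edge is adjacent to both of its ends. [folklore] -/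
theorem laApex_adj (i j : Fin 12) (h : laAdj (laCodeC i) (laCodeC j) = true) :
    laAdj (laCodeC i) (laCodeC (laApex i j)) = true ∧ laAdj (laCodeC j) (laCodeC (laApex i j)) = true := by
  revert h i j; decide

/-- **The 48 marked-edge substitutions permute the code set** (the rotation group of the cuboctahedron acts
simply transitively on ordered edges). [folklore] -/
theorem laFcc_subst (i j : Fin 12) (h : laAdj (laCodeC i) (laCodeC j) = true) :
    (∀ m : Fin 12, ∃ m' : Fin 12, (laFcc m).1 • laCodeC i + (laFcc m).2.1 • laCodeC j +
      (laFcc m).2.2 • laCodeC (laApex i j) = laCodeC m') ∧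
    (∀ m' : Fin 12, ∃ m : Fin 12, (laFcc m).1 • laCodeC i + (laFcc m).2.1 • laCodeC j +
      (laFcc m).2.2 • laCodeC (laApex i j) = laCodeC m') := by
  revert h i j; decide

/-- The code set is centrally symmetric, and `(2, -1, 1)` (the point `u - w + k e₃`) is not a code. [folklore] -/
theorem laCodeC_neg_mem (m : Fin 12) : (∃ m' : Fin 12, -laCodeC m = laCodeC m') ∧ laCodeC m ≠ (2, -1, 1) := by
  revert m; decide

/-! ## Geometry of the ideal model -/

/-- In the ideal cubic model all slots have norm `a'`. [folklore] -/
theorem norm_slotC_ideal {a' k : ℝ} (ha' : 0 < a') (hid : 3 * k ^ 2 = 2 * a' ^ 2) (i : Fin 12) :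
    ‖slotC a' k k i‖ = a' := by
  rw [slotC_eq_laPt]
  rcases la_norm_code (kp := k) (km := k) ha' true i with ⟨-, h⟩ | ⟨-, h⟩ | ⟨-, h⟩
  · exact h
  all_goals
    refine (pow_left_inj₀ (norm_nonneg _) ha'.le two_ne_zero).1 ?_
    rw [show laCode true = laCodeC from rfl] at h; rw [h]; linarith

/-- `‖u‖ = ‖v‖ = dist u v = a'`. [folklore] -/
theorem la_norm_uv {a' : ℝ} (ha' : 0 < a') : ‖triangularVec₁ a'‖ = a' ∧ ‖triangularVec₂ a'‖ = a' ∧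
    dist (triangularVec₁ a') (triangularVec₂ a') = a' := by
  have e1 : triangularVec₁ a' = (1 : ℝ) • triangularVec₁ a' + (0 : ℝ) • triangularVec₂ a' + (0 : ℝ) • layerNormal 1 := by
    module
  have e2 : triangularVec₂ a' = (0 : ℝ) • triangularVec₁ a' + (1 : ℝ) • triangularVec₂ a' + (0 : ℝ) • layerNormal 1 := by
    module
  have e3 : triangularVec₁ a' - triangularVec₂ a' =
      (1 : ℝ) • triangularVec₁ a' + (-1 : ℝ) • triangularVec₂ a' + (0 : ℝ) • layerNormal 1 := by module
  refine ⟨?_, ?_, ?_⟩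
  · rw [← sq_eq_sq₀ (norm_nonneg _) ha'.le]; conv_lhs => rw [e1]; rw [la_norm_sq]; ring
  · rw [← sq_eq_sq₀ (norm_nonneg _) ha'.le]; conv_lhs => rw [e2]; rw [la_norm_sq]; ring
  · rw [dist_eq_norm, ← sq_eq_sq₀ (norm_nonneg _) ha'.le, e3, la_norm_sq]; ring

/-- **Edges of the ideal model**: two slots are adjacent iff they are at distance exactly `a'` (the ideal model is
in the band at scale `a'`, where the atlas applies). [folklore] -/
theorem laAdj_iff_dist_ideal {a' k : ℝ} (ha' : 0 < a') (hk : 0 < k) (hid : 3 * k ^ 2 = 2 * a' ^ 2) (i j : Fin 12) :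
    laAdj (laCodeC i) (laCodeC j) = true ↔ dist (slotC a' k k i) (slotC a' k k j) = a' := by
  have hb : 0 < a' ∧ 0 < k ∧ 0 < k ∧ a' * (1 - 1 / 50) ≤ a' ∧ a' ≤ a' * (1 + 1 / 50) ∧
      (a' * (1 - 1 / 50)) ^ 2 ≤ a' ^ 2 / 3 + k ^ 2 ∧ a' ^ 2 / 3 + k ^ 2 ≤ (a' * (1 + 1 / 50)) ^ 2 ∧
      (a' * (1 - 1 / 50)) ^ 2 ≤ a' ^ 2 / 3 + k ^ 2 ∧ a' ^ 2 / 3 + k ^ 2 ≤ (a' * (1 + 1 / 50)) ^ 2 := by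
    refine ⟨ha', hk, hk, by linarith, by linarith, by nlinarith, by nlinarith, by nlinarith, by nlinarith⟩
  rw [slotC_eq_laPt, slotC_eq_laPt]
  constructor
  · intro h
    rcases la_dist_of_adj (kp := k) (km := k) ha' (laCodeC_level i) (laCodeC_level j) h with
      ⟨-, hd⟩ | ⟨-, -, hd⟩ | ⟨-, -, hd⟩
    · exact hd
    all_goals exact (pow_left_inj₀ dist_nonneg ha'.le two_ne_zero).1 (by rw [hd]; linarith)
  · intro hd
    have hij : i ≠ j := fun e => by rw [e, dist_self] at hd; linarith
    exact (la_dist_le_iff_adj hb true i j hij).1 (by rw [show laCode true = laCodeC from rfl, hd]; linarith)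

/-- **The apex over a marked edge.** A vector of norm `a'` at distance `a'` from `A u` and from `A v` is
`A (w + k e₃)` or `A (w - k e₃)`, `3k² = 2a'²`. [folklore] -/
theorem apex_eq {a' k : ℝ} (ha' : 0 < a') (hid : 3 * k ^ 2 = 2 * a' ^ 2)
    (A : EuclideanSpace ℝ (Fin 3) →ₗᵢ[ℝ] EuclideanSpace ℝ (Fin 3)) (y : EuclideanSpace ℝ (Fin 3))
    (hy : ‖y‖ = a') (hyu : dist y (A (triangularVec₁ a')) = a') (hyv : dist y (A (triangularVec₂ a')) = a') :
    y = A (barlowOffset a' + k • layerNormal 1) ∨ y = A (barlowOffset a' - k • layerNormal 1) := by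
  obtain ⟨y', hyy⟩ : ∃ y', A y' = y :=
    ⟨(A.toLinearIsometryEquiv rfl).symm y, (A.toLinearIsometryEquiv rfl).apply_symm_apply y⟩
  rw [← hyy, LinearIsometry.norm_map] at hy
  rw [← hyy, LinearIsometry.dist_map, dist_eq_norm] at hyu hyv
  have h3 : Real.sqrt 3 ^ 2 = 3 := Real.sq_sqrt (by norm_num)
  have e1 : y' 0 ^ 2 + y' 1 ^ 2 + y' 2 ^ 2 = a' ^ 2 := by
    have := hy; rw [← sq_eq_sq₀ (norm_nonneg _) ha'.le, EuclideanSpace.norm_sq_eq, Fin.sum_univ_three] at this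
    simpa [Real.norm_eq_abs, sq_abs] using this
  have e2 : (y' 0 - a') ^ 2 + y' 1 ^ 2 + y' 2 ^ 2 = a' ^ 2 := by
    have := hyu; rw [← sq_eq_sq₀ (norm_nonneg _) ha'.le, EuclideanSpace.norm_sq_eq, Fin.sum_univ_three] at this
    simpa [Real.norm_eq_abs, sq_abs, triangularVec₁] using this
  have e3 : (y' 0 - a' / 2) ^ 2 + (y' 1 - a' * Real.sqrt 3 / 2) ^ 2 + y' 2 ^ 2 = a' ^ 2 := by
    have := hyv; rw [← sq_eq_sq₀ (norm_nonneg _) ha'.le, EuclideanSpace.norm_sq_eq, Fin.sum_univ_three] at this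
    simpa [Real.norm_eq_abs, sq_abs, triangularVec₂] using this
  have f0 : y' 0 = a' / 2 := by nlinarith
  have f1 : y' 1 = a' * Real.sqrt 3 / 6 := by
    have h : a' * Real.sqrt 3 * (y' 1 - a' * Real.sqrt 3 / 6) = 0 := by nlinarith
    rcases mul_eq_zero.1 h with h' | h'
    · exact absurd h' (by positivity)
    · linarith
  have f2 : (y' 2 - k) * (y' 2 + k) = 0 := by rw [f0, f1] at e1; nlinarith
  rcases mul_eq_zero.1 f2 with f2 | f2
  · left; rw [← hyy]; congr 1; ext l
    fin_cases l <;> simp [barlowOffset, layerNormal, f0, f1]; linarith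
  · right; rw [← hyy]; congr 1; ext l
    fin_cases l <;> simp [barlowOffset, layerNormal, f0, f1]; linarith

/-! ## The core: a cuboctahedron with a marked edge -/

/-- **Cuboctahedron with a marked edge.** If `S` is a perfect cuboctahedron `p + A' K` (cubic type, both heights
`k`, `3k² = 2a''²`) and contains `p + A u`, `p + A v` (frame `A`, spacing `a' > 0`), then `a'' = a'` and
`S = p + A K` or `S = p + A R_π K` (the twin across the plane of the marked edge). [folklore] -/
theorem cuboct_marked_edge (S : Set (EuclideanSpace ℝ (Fin 3))) (p : EuclideanSpace ℝ (Fin 3)) (a'' k : ℝ)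
    (A' : EuclideanSpace ℝ (Fin 3) →ₗᵢ[ℝ] EuclideanSpace ℝ (Fin 3)) (ha'' : 0 < a'') (hk : 0 < k)
    (hid : 3 * k ^ 2 = 2 * a'' ^ 2) (hS : S = Set.range fun i : Fin 12 => p + A' (slotC a'' k k i))
    (a' : ℝ) (A : EuclideanSpace ℝ (Fin 3) →ₗᵢ[ℝ] EuclideanSpace ℝ (Fin 3)) (ha' : 0 < a')
    (hu : p + A (triangularVec₁ a') ∈ S) (hv : p + A (triangularVec₂ a') ∈ S) :
    a'' = a' ∧ ((S = Set.range fun i : Fin 12 => p + A (slotC a' k k i)) ∨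
      (S = Set.range fun i : Fin 12 => p + A (laHalfTurn (slotC a' k k i)))) := by
  subst hS
  obtain ⟨i₀, hi₀⟩ := hu
  obtain ⟨j₀, hj₀⟩ := hv
  have hi : A' (slotC a'' k k i₀) = A (triangularVec₁ a') := by simpa using hi₀
  have hj : A' (slotC a'' k k j₀) = A (triangularVec₂ a') := by simpa using hj₀
  obtain ⟨nu, -, duv⟩ := la_norm_uv ha'
  have haa : a'' = a' := by rw [← norm_slotC_ideal ha'' hid i₀, ← A'.norm_map, hi, A.norm_map, nu]
  subst haa
  refine ⟨rfl, ?_⟩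
  -- the marked edge is an edge of the model; its apex
  have hadj : laAdj (laCodeC i₀) (laCodeC j₀) = true :=
    (laAdj_iff_dist_ideal ha'' hk hid i₀ j₀).2 (by rw [← A'.dist_map, hi, hj, A.dist_map, duv])
  obtain ⟨m₀, hm₀⟩ : ∃ m₀ : Fin 12, laApex i₀ j₀ = m₀ := ⟨_, rfl⟩
  obtain ⟨hai, haj⟩ := laApex_adj i₀ j₀ hadj
  obtain ⟨fwd, bwd⟩ := laFcc_subst i₀ j₀ hadj
  rw [hm₀] at hai haj fwd bwd
  have hy : A' (slotC a'' k k m₀) = A (barlowOffset a'' + k • layerNormal 1) ∨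
      A' (slotC a'' k k m₀) = A (barlowOffset a'' - k • layerNormal 1) := by
    refine apex_eq ha'' hid A _ (by rw [A'.norm_map, norm_slotC_ideal ha'' hid]) ?_ ?_
    · rw [← hi, A'.dist_map, dist_comm]; exact (laAdj_iff_dist_ideal ha'' hk hid i₀ m₀).1 hai
    · rw [← hj, A'.dist_map, dist_comm]; exact (laAdj_iff_dist_ideal ha'' hk hid j₀ m₀).1 haj
  obtain ⟨bu, bv, bp, bm, -⟩ := laLin_basis a'' k
  -- transport of integer combinations
  have tr : ∀ (ε : ℤ), (ε = 1 ∨ ε = -1) → A' (slotC a'' k k m₀) = A (laLin a'' k (1, 1, ε)) →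
      ∀ m : Fin 12, A (laLin a'' k ((laCodeC m).1, (laCodeC m).2.1, ε * (laCodeC m).2.2)) =
        A' (laLin a'' k ((laFcc m).1 • laCodeC i₀ + (laFcc m).2.1 • laCodeC j₀ + (laFcc m).2.2 • laCodeC m₀)) := by
    intro ε hε hap m
    rw [laCodeC_eq_fcc ε hε m, laLin_comb, laLin_comb]
    simp only [map_add, LinearIsometry.map_smul, bu, bv, ← hi, ← hj, ← hap, slotC_eq_laLin]
  rcases hy with hy | hy
  · -- the apex is `A (w + k e₃)`: `S = p + A K`
    left
    rw [← bp] at hy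
    have e1 : ∀ m : Fin 12, ((laCodeC m).1, (laCodeC m).2.1, 1 * (laCodeC m).2.2) = laCodeC m := fun m => by simp
    ext x
    simp only [Set.mem_range]
    constructor
    · rintro ⟨m', rfl⟩
      obtain ⟨m, hm⟩ := bwd m'
      refine ⟨m, ?_⟩
      show p + A (slotC a'' k k m) = p + A' (slotC a'' k k m')
      rw [slotC_eq_laLin a'' k m, ← e1 m, tr 1 (Or.inl rfl) hy m, hm, slotC_eq_laLin]
    · rintro ⟨m, rfl⟩
      obtain ⟨m', hm'⟩ := fwd m
      refine ⟨m', ?_⟩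
      show p + A' (slotC a'' k k m') = p + A (slotC a'' k k m)
      rw [slotC_eq_laLin a'' k m, ← e1 m, tr 1 (Or.inl rfl) hy m, hm', slotC_eq_laLin]
  · -- the apex is `A (w - k e₃)`: `S = p + A R_π K`
    right
    rw [← bm] at hy
    have tw : ∀ m : Fin 12, A (laHalfTurn (slotC a'' k k m)) =
        -A (laLin a'' k ((laCodeC m).1, (laCodeC m).2.1, -1 * (laCodeC m).2.2)) := by
      intro m
      rw [slotC_eq_laLin, (laHalfTurn_laLin a'' k _).1, ← map_neg, ← laLin_neg]
      simp
    ext x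
    simp only [Set.mem_range]
    constructor
    · rintro ⟨m', rfl⟩
      obtain ⟨n', hn'⟩ := (laCodeC_neg_mem m').1
      obtain ⟨m, hm⟩ := bwd n'
      refine ⟨m, ?_⟩
      show p + A (laHalfTurn (slotC a'' k k m)) = p + A' (slotC a'' k k m')
      rw [tw, tr (-1) (Or.inr rfl) hy m, hm, slotC_eq_laLin a'' k m', ← neg_neg (laCodeC m'), hn', laLin_neg,
        map_neg]
    · rintro ⟨m, rfl⟩
      obtain ⟨m', hm'⟩ := fwd m
      obtain ⟨n', hn'⟩ := (laCodeC_neg_mem m').1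
      refine ⟨n', ?_⟩
      show p + A' (slotC a'' k k n') = p + A (laHalfTurn (slotC a'' k k m))
      rw [tw, tr (-1) (Or.inr rfl) hy m, hm', slotC_eq_laLin a'' k n', ← hn', laLin_neg, map_neg]

/-! ## The anchor: the in-plane step when every shell is a perfect cuboctahedron -/

/-- **Cuboctahedral in-plane step.** If every bond shell of `Z` is a perfect cuboctahedron (cubic type, both
heights ideal) and the shell of `p` is `p + A K` (spacing `a'`, height `h`, `3h² = 2a'²`), then the shell of the
in-plane neighbour `q = p + A u` is `q + A K`: by `cuboct_marked_edge` (marked edge `-A u = A R_π u`,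
`-A v = A R_π v`) it is `q + A R_π K` or `q + A R_π R_π K = q + A K`, and the former misses the common cap point
`p + A (w + h e₃) = q + A (w - u + h e₃)`. [folklore] -/
theorem stub_cuboctStep (Z : Set (EuclideanSpace ℝ (Fin 3))) (a : ℝ) (ha : 0 < a)
    (hall : ∀ y ∈ Z, ∃ (b k : ℝ) (B : EuclideanSpace ℝ (Fin 3) →ₗᵢ[ℝ] EuclideanSpace ℝ (Fin 3)),
      0 < b ∧ 0 < k ∧ 3 * k ^ 2 = 2 * b ^ 2 ∧ bondShell a Z y = Set.range fun i : Fin 12 => y + B (slotC b k k i))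
    (p : EuclideanSpace ℝ (Fin 3)) (hp : p ∈ Z) (a' h : ℝ)
    (A : EuclideanSpace ℝ (Fin 3) →ₗᵢ[ℝ] EuclideanSpace ℝ (Fin 3)) (ha' : 0 < a') (hh : 0 < h)
    (hid : 3 * h ^ 2 = 2 * a' ^ 2)
    (hS : bondShell a Z p = Set.range fun i : Fin 12 => p + A (slotC a' h h i)) :
    bondShell a Z (p + A (triangularVec₁ a')) =
      Set.range fun i : Fin 12 => p + A (triangularVec₁ a') + A (slotC a' h h i) := by
  have _ := ha
  obtain ⟨q, hq⟩ : ∃ q, q = p + A (triangularVec₁ a') := ⟨_, rfl⟩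
  rw [← hq]
  obtain ⟨bu, bv, bp, -, bc⟩ := laLin_basis a' h
  obtain ⟨nu, nv, -⟩ := la_norm_uv ha'
  have nrm : ∀ i, ‖slotC a' h h i‖ = a' := norm_slotC_ideal ha' hid
  -- shell points of `p` as shell points of `q`
  have mem : ∀ i : Fin 12, p + A (slotC a' h h i) ∈ bondShell a Z p := fun i => by rw [hS]; exact ⟨i, rfl⟩
  have s0 : slotC a' h h 0 = triangularVec₁ a' := by simp [slotC]
  obtain ⟨hqZ, -, hqd⟩ : q ∈ bondShell a Z p := by rw [hq, ← s0]; exact mem 0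
  have hpq : dist p q = a' := by rw [hq, dist_comm, dist_eq_norm, add_sub_cancel_left, A.norm_map, nu]
  have ha'le : a' ≤ a * (1 + 1 / 50) := hpq ▸ hqd
  have memq : ∀ x : EuclideanSpace ℝ (Fin 3), ‖x‖ = a' → q + A x ∈ Z → q + A x ∈ bondShell a Z q := by
    intro x hx hZ
    refine ⟨hZ, fun e => ?_, ?_⟩
    · have h0 : A x = 0 := add_eq_left.1 e
      rw [← A.norm_map, h0, norm_zero] at hx; linarith
    · rw [dist_eq_norm, sub_add_cancel_left, norm_neg, A.norm_map, hx]; exact ha'le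
  have hpS : q + A (-triangularVec₁ a') ∈ bondShell a Z q :=
    memq _ (by rw [norm_neg, nu]) (by rw [hq, map_neg, add_neg_cancel_right]; exact hp)
  have hxS : q + A (-triangularVec₂ a') ∈ bondShell a Z q := by
    refine memq _ (by rw [norm_neg, nv]) ?_
    have e : q + A (-triangularVec₂ a') = p + A (slotC a' h h 4) := by
      rw [hq, show slotC a' h h 4 = triangularVec₁ a' - triangularVec₂ a' by simp [slotC], map_sub, map_neg]; abel
    rw [e]; exact (mem 4).1
  have e7 : slotC a' h h 7 = laLin a' h (-2, 1, 1) := by rw [slotC_eq_laLin]; rfl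
  have hcS : q + A (laLin a' h (-2, 1, 1)) ∈ bondShell a Z q := by
    refine memq _ (by rw [← e7]; exact nrm 7) ?_
    have e : q + A (laLin a' h (-2, 1, 1)) = p + A (slotC a' h h 6) := by
      rw [hq, bc, show slotC a' h h 6 = h • layerNormal 1 + barlowOffset a' by simp [slotC]]
      simp only [map_add, map_sub, map_smul]; abel
    rw [e]; exact (mem 6).1
  -- the marked edge `A R_π u, A R_π v` of the cuboctahedron `bondShell a Z q`
  obtain ⟨re, ru, rv⟩ := laHalfTurn_basis a'
  obtain ⟨b, k, B, hb, hk, hidq, hSq⟩ := hall q hqZ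
  obtain ⟨hba, hcases⟩ := cuboct_marked_edge (bondShell a Z q) q b k B hb hk hidq hSq a'
    (A.comp laHalfTurn.toLinearIsometry) ha'
    (by simpa [ru] using hpS) (by simpa [rv] using hxS)
  subst hba
  have hkh : k = h := (pow_left_inj₀ hk.le hh.le two_ne_zero).1 (by nlinarith)
  subst hkh
  have rr := (laHalfTurn_laLin b k (0, 0, 0)).2
  rcases hcases with hT | hT
  · -- the twin `q + A R_π K` misses the cap point
    exfalso
    rw [hT] at hcS
    obtain ⟨m, hm⟩ := hcS
    have h1 : laHalfTurn (slotC b k k m) = laLin b k (-2, 1, 1) := A.injective (by simpa using hm)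
    have h2 : slotC b k k m = laLin b k (2, -1, 1) := by
      rw [← rr (slotC b k k m), h1, (laHalfTurn_laLin b k _).1]; norm_num
    rw [slotC_eq_laLin] at h2
    exact (laCodeC_neg_mem m).2 (laLin_injective hb.ne' hk.ne' h2)
  · rw [hT]
    ext x
    simp only [Set.mem_range, LinearIsometry.coe_comp, Function.comp_apply, LinearIsometryEquiv.coe_toLinearIsometry,
      rr]

end Summit.AtomisticToContinuum.Crystallization.Theorems.CleanHull

end
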